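/-
Copyright (c) 2026. All rights reserved.
Released under Apache 2.0 license as described in the file LICENSE.
Authors: abc-iut cell — abc-iut-w4-d064 (gen 3), over abc-iut-w4-d083's `ArithCor39cTransport`,
abc-iut-w4-d080's `TemperedCor39cDischargeAt` and abc-iut-L3-t8's finite-graph Thm. 3.7 (iii).
-/
import Literature.AnabelianGeometry.SemiGraphs.TemperedCompactInVerticialFinite
import Literature.AnabelianGeometry.SemiGraphs.ArithCor39cTransport
import HarnessLib

/-!
# [SemiAnbd] the Thm 5.4 (iii) junction binder `hCor39c` TRANSPORTED AND DISCHARGED for FINITE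
# semi-graphs of anabelioids — UNCONDITIONAL (kernel level; and Cor. 3.9 (b) ⟺ shadows at the charts)

Mochizuki, *Semi-graphs of anabelioids*, Publ. RIMS **42** (2006), §3, Cor. 3.9, ms pp. 42–43 (proof p. 43:
"by Theorem 3.7, (iii), (iv)"; proof of Thm. 3.7 (iii) p. 41: "the semi-graphs `𝔾_j` are all finite");
§5, Thm. 5.4 (iii), p. 66 ("entirely parallel to those of Theorem 3.7, Corollary 3.9")
[cite: MochizukiSemiAnbd2006, Cor 3.9 pp.42-43; Thm 5.4 (iii) p.66].

PROOF-ONLY (0 defs; cell abc-iut, layer L3, DAG nodes SemiAnbd:Cor3.9 / SemiAnbd:Thm5.4(iii) junction).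
abc-iut-w4-d080's per-pair discharge of the junction binder `hCor39c` (`TemperedCor39cDischargeAt.lean`:
shadows (hV)(hE)(hC) of `φ` ⟹ `φ` induced up to twist by a locally open `F : 𝒢 → ℋ`, with the Prop. 3.6 (iv)
compatibilities and uniqueness of the underlying morphism of semi-graphs; and conversely) and
abc-iut-w4-d083's kernel-level transport (`ArithCor39cTransport.lean`: the three antecedents of `hCor39c` for
a continuous `f : Π^temp_𝔊 → Π^temp_ℍ` over `A` ⟹ the chart-level shadows ⟹ the same conclusion for the
restriction `f'`) are stated MODULO Thm. 3.7 (iii) AT `𝒢` AND AT `ℋ` (`CompactInVerticialAt`).  For FINITE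
`𝒢`, `ℋ` both inputs are THEOREMS (abc-iut-L3-t8 `compactInVerticialAt_of_finiteGraph`,
`TemperedCompactInVerticialFinite.lean`), so every statement below holds with NO residual hypothesis beyond
the printed hypotheses of Cor. 3.9 (`Cor39Hypotheses`) and the producer's chart / embedding / action data —
print's generality for the dual semi-graphs of pointed stable curves (Ex. 3.10 / Cor. 3.11 / Ex. 5.6).  The
chart-level closers at finite graphs are abc-iut-w4-d080's (`TemperedCor39JunctionFinite.lean`; the `iff`
below is their conjunction, proved directly from the At-theorems); this file adds the KERNEL-level transport (the branch dictionary
`Π^temp_{𝔊,b} ∩ Ker = ι(Π^temp_{𝔾,b})`, antecedent 2 ⇒ (hE), and the full `hCor39c` discharge for `f` over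
`A`).  "Induced" is read up to twist (cell ruling ξ2).
Nothing here asserts Thm. 3.7 (iii) for an infinite `𝔾` or [SemiAnbd] Thm. 5.4 for real data; nothing takes a
side on [IUTchIII] Cor. 3.12; typed ≠ discharged.
-/

open CategoryTheory Topology

namespace Literature.AnabelianGeometry.SemiGraphs

namespace ProfiniteSemiGraph

universe u uG uH uP

variable {𝒢 ℋ : ProfiniteSemiGraph.{u}}

/-! ### Chart level: Cor. 3.9 (b) ⟺ shadows at finite graphs -/

/-- **Cor. 3.9 (b) at FINITE graphs as an `iff` — unconditional**: `φ` is induced up to twist by SOME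
locally open morphism `𝒢 → ℋ` if and only if it has the three shadows (hV), (hE), (hC).
[cite: MochizukiSemiAnbd2006, Cor 3.9 pp.42-43] -/
theorem exists_hom_chartPullbackWith_iso_iff_shadows_of_finite [Finite 𝒢.graph.Vertex]
    [Finite 𝒢.graph.Edge] [Finite ℋ.graph.Vertex] [Finite ℋ.graph.Edge]
    (h𝒢 : Cor39Hypotheses 𝒢) (hℋ : Cor39Hypotheses ℋ)
    (c𝒢 : TemperedPiChart 𝒢) (cℋ : TemperedPiChart ℋ) (φ : c𝒢.G →ₜ* cℋ.G) :
    (∃ F : Hom 𝒢 ℋ, F.IsLocallyOpen ∧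
      ∃ θ : F.ConjugatorFamily, Nonempty (F.chartPullbackWith θ c𝒢 cℋ ≅ BTemp.res φ)) ↔
    ((∀ (v : 𝒢.graph.Vertex) (K : Subgroup c𝒢.G), K ∈ verticialSubgroups c𝒢 v →
      ∃ (w : ℋ.graph.Vertex) (K₂ : Subgroup cℋ.G), K₂ ∈ verticialSubgroups cℋ w ∧
        MapsOntoOpenSubgroupOf φ.toMonoidHom K K₂) ∧
    (∀ (e : 𝒢.graph.Edge) (L : Subgroup c𝒢.G), 𝒢.graph.IsClosedEdge e →
      L ∈ edgeLikeSubgroups c𝒢 e → L ≠ ⊥ →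
      ∃ (e' : ℋ.graph.Edge) (L₂ : Subgroup cℋ.G), ℋ.graph.IsClosedEdge e' ∧
        L₂ ∈ edgeLikeSubgroups cℋ e' ∧ L₂ ≠ ⊥ ∧ MapsOntoOpenSubgroupOf φ.toMonoidHom L L₂) ∧
    (∀ (v₁ v₂ : 𝒢.graph.Vertex) (K₁ H₁ : Subgroup c𝒢.G), K₁ ∈ verticialSubgroups c𝒢 v₁ →
      H₁ ∈ verticialSubgroups c𝒢 v₂ → K₁ ≠ H₁ → K₁ ⊓ H₁ ≠ ⊥ →
      ∃ (w₁ w₂ : ℋ.graph.Vertex) (K₂ H₂ : Subgroup cℋ.G), K₂ ∈ verticialSubgroups cℋ w₁ ∧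
        H₂ ∈ verticialSubgroups cℋ w₂ ∧ K₂ ≠ H₂ ∧ K₁.map φ.toMonoidHom ≤ K₂ ∧
        H₁.map φ.toMonoidHom ≤ H₂)) := by
  constructor
  · rintro ⟨F, hF, hind⟩
    exact shadows_of_exists_chartPullbackWith_isoAt compactInVerticialAt_of_finiteGraph
      compactInVerticialAt_of_finiteGraph h𝒢 hℋ c𝒢 cℋ F φ hF hind
  · rintro ⟨hV, hE, hC⟩
    exact exists_hom_chartPullbackWith_iso_of_shadowsAt compactInVerticialAt_of_finiteGraph
      compactInVerticialAt_of_finiteGraph h𝒢 hℋ c𝒢 cℋ φ hV hE hC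

/-! ### Kernel level (abc-iut-w4-d083's transport, at finite graphs) -/

variable {c𝒢 : TemperedPiChart 𝒢} {cℋ : TemperedPiChart ℋ}
variable {Gtp : Type uG} [Group Gtp]
variable {Htp : Type uH} [Group Htp] [TopologicalSpace Htp]
variable {PA : Type uP} [Group PA] [TopologicalSpace PA]

omit [TopologicalSpace PA] in
/-- `Π^temp_{𝔊,b} ∩ Ker aug = ι(Π^temp_{𝔾,b})` for the produced decomposition data of a FINITE `𝔾` —
unconditional (abc-iut-w4-d083's `brGp_inf_ker_eq_map` with Thm. 3.7 (iii) at `𝔾` discharged).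
[cite: MochizukiSemiAnbd2006, §5, p. 65] -/
theorem brGp_inf_ker_eq_map_of_finite [Finite 𝒢.graph.Vertex] [Finite 𝒢.graph.Edge]
    (h𝒢 : 𝒢.Thm37Hypotheses) (hG : 𝒢.graph.IsGraph) (R : ChartRepresentatives c𝒢) (ι : c𝒢.G →* Gtp)
    (hι : Function.Injective ι) (aug : Gtp →* PA) (hexact : ι.range = aug.ker) (b : 𝒢.graph.Branch) :
    (decompositionDataOfChart R ι).brGp b ⊓ aug.ker = (R.Hb b).map ι :=
  brGp_inf_ker_eq_map compactInVerticialAt_of_finiteGraph h𝒢 hG R ι hι aug hexact b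

omit [TopologicalSpace Htp] in
/-- The geometric part of an arbitrary conjugate `x·Π^temp_{ℍ,b}·x⁻¹` is `ι` of an edge-like subgroup of the
translated closed edge, for a FINITE `ℍ` — unconditional. [cite: MochizukiSemiAnbd2006, §5, p. 65] -/
theorem conj_brGp_inf_ker_eq_map_of_finite [Finite ℋ.graph.Vertex] [Finite ℋ.graph.Edge]
    (hℋ : ℋ.Thm37Hypotheses) (hH : ℋ.graph.IsGraph) (R' : ChartRepresentatives cℋ) (ι : cℋ.G →* Htp)
    (hι : Function.Injective ι) (aug : Htp →* PA) (hexact : ι.range = aug.ker)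
    {actV : PA → ℋ.graph.Vertex → ℋ.graph.Vertex} {actE : PA → ℋ.graph.Edge → ℋ.graph.Edge}
    {actB : PA → ℋ.graph.Branch → ℋ.graph.Branch} (A : ArithChartAction cℋ ι aug actV actE actB)
    (x : Htp) (b : ℋ.graph.Branch) :
    ∃ K' ∈ edgeLikeSubgroups cℋ (actE (aug x) (ℋ.graph.edgeOf b)),
      conjSubgroup x ((decompositionDataOfChart R' ι).brGp b) ⊓ aug.ker = K'.map ι :=
  conj_brGp_inf_ker_eq_map compactInVerticialAt_of_finiteGraph hℋ hH R' ι hι aug hexact A x b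

/-- **Antecedent 2 ⇒ `hE` at FINITE graphs — unconditional**: if `f` maps the geometric part of every
`Π^temp_{𝔊,b}` onto an open subgroup of the geometric part of a conjugate of some `Π^temp_{ℍ,b'}`, then the
restriction `f'` maps every edge-like subgroup of a closed edge of `π₁^temp(𝔾)` onto an open subgroup of an
edge-like subgroup of a closed edge of `π₁^temp(ℍ)`. [cite: MochizukiSemiAnbd2006, Thm 5.4 (iii), p. 66] -/
theorem shadowE_of_kernelShadowE_of_finite [IsTopologicalGroup Htp] [Finite 𝒢.graph.Vertex]
    [Finite 𝒢.graph.Edge] [Finite ℋ.graph.Vertex] [Finite ℋ.graph.Edge]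
    (h𝒢 : Cor39Hypotheses 𝒢) (hℋ : Cor39Hypotheses ℋ)
    (R : ChartRepresentatives c𝒢) (R' : ChartRepresentatives cℋ)
    (ι𝒢 : c𝒢.G →* Gtp) (ιℋ : cℋ.G →* Htp) (hι𝒢 : Function.Injective ι𝒢) (hιℋ : Function.Injective ιℋ)
    (hιℋc : Continuous ιℋ) (augG : Gtp →* PA) (augH' : Htp →* PA) (hex𝒢 : ι𝒢.range = augG.ker)
    (hexℋ : ιℋ.range = augH'.ker)
    {actV : PA → ℋ.graph.Vertex → ℋ.graph.Vertex} {actE : PA → ℋ.graph.Edge → ℋ.graph.Edge}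
    {actB : PA → ℋ.graph.Branch → ℋ.graph.Branch} (A : ArithChartAction cℋ ιℋ augH' actV actE actB)
    {f : Gtp →* Htp} {f' : c𝒢.G →* cℋ.G} (hf' : ∀ x, ιℋ (f' x) = f (ι𝒢 x))
    (h2 : ∀ b : 𝒢.graph.Branch, ∃ (b' : ℋ.graph.Branch) (x : Htp),
      MapsOntoOpenSubgroupOf f ((decompositionDataOfChart R ι𝒢).brGp b ⊓ augG.ker)
        (conjSubgroup x ((decompositionDataOfChart R' ιℋ).brGp b') ⊓ augH'.ker)) :
    ∀ (e : 𝒢.graph.Edge) (L : Subgroup c𝒢.G), 𝒢.graph.IsClosedEdge e →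
      L ∈ edgeLikeSubgroups c𝒢 e → L ≠ ⊥ →
      ∃ (e' : ℋ.graph.Edge) (L₂ : Subgroup cℋ.G), ℋ.graph.IsClosedEdge e' ∧
        L₂ ∈ edgeLikeSubgroups cℋ e' ∧ MapsOntoOpenSubgroupOf f' L L₂ :=
  shadowE_of_kernelShadowE compactInVerticialAt_of_finiteGraph compactInVerticialAt_of_finiteGraph h𝒢 hℋ
    R R' ι𝒢 ιℋ hι𝒢 hιℋ hιℋc augG augH' hex𝒢 hexℋ A hf' h2

/-- **`hCor39c`, transported and discharged at the charts, for FINITE graphs — unconditional**: for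
`f : Π^temp_𝔊 → Π^temp_ℍ` continuous over `A` satisfying the three kernel-level antecedents of the
Thm 5.4 (iii) junction binder `hCor39c` (per-vertex shadow, per-branch shadow, compatibility shadow), the
restriction `f'` of `f` to the geometric tempered groups is induced, up to twist, by a LOCALLY OPEN morphism of
semi-graphs of anabelioids `F : 𝔾 → ℍ` — with no Thm. 3.7 (iii) hypothesis left (both discharged by
abc-iut-L3-t8's `compactInVerticialAt_of_finiteGraph`). [cite: MochizukiSemiAnbd2006, Thm 5.4 (iii), p. 66] -/
theorem exists_hom_chartPullbackWith_iso_of_kernelShadows_of_finite [TopologicalSpace Gtp]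
    [IsTopologicalGroup Htp] [Finite 𝒢.graph.Vertex] [Finite 𝒢.graph.Edge] [Finite ℋ.graph.Vertex]
    [Finite ℋ.graph.Edge] (h𝒢 : Cor39Hypotheses 𝒢) (hℋ : Cor39Hypotheses ℋ)
    (R : ChartRepresentatives c𝒢) (R' : ChartRepresentatives cℋ)
    (ι𝒢 : c𝒢.G →* Gtp) (ιℋ : cℋ.G →* Htp) (hι𝒢 : Function.Injective ι𝒢) (hι𝒢c : Continuous ι𝒢)
    (hιℋ : Function.Injective ιℋ) (hιℋe : IsEmbedding ιℋ)
    (augG : Gtp →* PA) (augH' : Htp →* PA) (hex𝒢 : ι𝒢.range = augG.ker) (hexℋ : ιℋ.range = augH'.ker)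
    {actV : PA → ℋ.graph.Vertex → ℋ.graph.Vertex} {actE : PA → ℋ.graph.Edge → ℋ.graph.Edge}
    {actB : PA → ℋ.graph.Branch → ℋ.graph.Branch} (A : ArithChartAction cℋ ιℋ augH' actV actE actB)
    (f : Gtp →* Htp) (hf : Continuous f) (hover : augH'.comp f = augG)
    (h1 : ∀ v : 𝒢.graph.Vertex, ∃ (w : ℋ.graph.Vertex) (x : Htp),
      MapsOntoOpenSubgroupOf f ((decompositionDataOfChart R ι𝒢).vertGp v ⊓ augG.ker)
        (conjSubgroup x ((decompositionDataOfChart R' ιℋ).vertGp w) ⊓ augH'.ker))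
    (h2 : ∀ b : 𝒢.graph.Branch, ∃ (b' : ℋ.graph.Branch) (x : Htp),
      MapsOntoOpenSubgroupOf f ((decompositionDataOfChart R ι𝒢).brGp b ⊓ augG.ker)
        (conjSubgroup x ((decompositionDataOfChart R' ιℋ).brGp b') ⊓ augH'.ker))
    (h3 : ∀ (v₁ v₂ : 𝒢.graph.Vertex) (γ₁ γ₂ : Gtp),
      conjSubgroup γ₁ ((decompositionDataOfChart R ι𝒢).vertGp v₁) ⊓ augG.ker ≠
          conjSubgroup γ₂ ((decompositionDataOfChart R ι𝒢).vertGp v₂) ⊓ augG.ker →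
      conjSubgroup γ₁ ((decompositionDataOfChart R ι𝒢).vertGp v₁) ⊓
          conjSubgroup γ₂ ((decompositionDataOfChart R ι𝒢).vertGp v₂) ⊓ augG.ker ≠ ⊥ →
        ∃ (w₁ w₂ : ℋ.graph.Vertex) (x₁ x₂ : Htp),
          conjSubgroup x₁ ((decompositionDataOfChart R' ιℋ).vertGp w₁) ⊓ augH'.ker ≠
              conjSubgroup x₂ ((decompositionDataOfChart R' ιℋ).vertGp w₂) ⊓ augH'.ker ∧
          (conjSubgroup γ₁ ((decompositionDataOfChart R ι𝒢).vertGp v₁) ⊓ augG.ker).map f ≤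
              conjSubgroup x₁ ((decompositionDataOfChart R' ιℋ).vertGp w₁) ∧
          (conjSubgroup γ₂ ((decompositionDataOfChart R ι𝒢).vertGp v₂) ⊓ augG.ker).map f ≤
              conjSubgroup x₂ ((decompositionDataOfChart R' ιℋ).vertGp w₂)) :
    ∃ f' : c𝒢.G →ₜ* cℋ.G, (∀ x, ιℋ (f' x) = f (ι𝒢 x)) ∧
      ∃ F : Hom 𝒢 ℋ, F.IsLocallyOpen ∧
        ∃ θ : F.ConjugatorFamily, Nonempty (F.chartPullbackWith θ c𝒢 cℋ ≅ BTemp.res f') :=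
  exists_hom_chartPullbackWith_iso_of_kernelShadows compactInVerticialAt_of_finiteGraph
    compactInVerticialAt_of_finiteGraph h𝒢 hℋ R R' ι𝒢 ιℋ hι𝒢 hι𝒢c hιℋ hιℋe augG augH' hex𝒢 hexℋ A f hf
    hover h1 h2 h3

end ProfiniteSemiGraph

end Literature.AnabelianGeometry.SemiGraphs
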